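import Summits.ResolutionOfSingularities.ResolutionOfSingularities.Theorems.FrobeniusLadderFRationalResolutionToricFiniteType
import HarnessLib

/-!
# Toric surface programme: `U(r,a) → Spec k` is locally of finite type

Support file for crux stmt-ResolutionOfSingularities-15317 (`FrobeniusLadder.FRationalResolution`), line `redirect`,
lead c4 (toric surface programme: all affine toric surfaces `U(r,a) = Spec k[{m ∈ ℤ² : 0 ≤ m₂, a m₂ ≤ r m₁}]` over every
field lie in the crux's residual class and are resolved by the Hirzebruch–Jung tower; `LocallyOfFiniteType` is the
load-bearing hypothesis of the crux by the Disproof's Negative/FiniteTypeLoadBearing).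

The scheme form of Gordan's lemma for the cone `σ∨ = {m₂ ≥ 0, a m₂ ≤ r m₁}`: the structure morphism
`Spec k[σ∨ ∩ ℤ²] → Spec k` is locally of finite type, since `k[σ∨ ∩ ℤ²]` is a finite-type `k`-algebra
(`stub_toric_finiteType`) and `LocallyOfFiniteType` of `Spec` of a ring map is `RingHom.FiniteType` of that map
(Mathlib's `HasRingHomProperty.Spec_iff`). Folklore (Cox–Little–Schenck 2011, Prop. 1.2.17; Fulton 1993 §1.2);
no published fact is used.
-/

-- single-problem summit: the doubled namespace component is forced
set_option linter.dupNamespace false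

noncomputable section

namespace Summit.ResolutionOfSingularities.ResolutionOfSingularities.Theorems.FRationalResolution

open CategoryTheory AlgebraicGeometry TopologicalSpace
open Literature.AlgebraicGeometry.Resolution

section Toric

variable (k : Type) [Field k]

/-- The Laurent polynomial ring `k[ℤ²]` (coordinate ring of the 2-torus). -/
local notation3 "Lk" => AddMonoidAlgebra k (ℤ × ℤ)

/-- The lattice points of the dual cone `σ∨ = {m₂ ≥ 0, a m₂ ≤ r m₁}` of `σ = cone((0,1),(r,-a))`. -/
local notation3 "σS[" r ", " a "]" =>
  {m : ℤ × ℤ | 0 ≤ m.2 ∧ ((a : ℕ) : ℤ) * m.2 ≤ ((r : ℕ) : ℤ) * m.1}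

/-- The toric surface algebra `k[σ∨ ∩ ℤ²] ⊆ k[ℤ²]`. -/
local notation3 "TA[" r ", " a "]" =>
  Algebra.adjoin k ((fun m : ℤ × ℤ => AddMonoidAlgebra.single m (1 : k)) '' σS[r, a])

/-- STUB (finite type, scheme form): for `1 ≤ r`, `a ≤ r` the structure morphism
`U(r,a) = Spec TA[r,a] → Spec k` is locally of finite type: `TA[r,a]` is a finite-type `k`-algebra
(`stub_toric_finiteType`, Gordan's lemma for the cone `σ∨`), i.e. `algebraMap k TA[r,a]` is
`RingHom.FiniteType` (`RingHom.finiteType_algebraMap`), and `LocallyOfFiniteType (Spec.map f)` is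
`RingHom.FiniteType f` (`HasRingHomProperty.Spec_iff`); cf. c3's `An_locallyOfFiniteType`.
[folklore; CLS2011 Prop. 1.2.17] -/
theorem stub_toric_locallyOfFiniteType (r a : ℕ) (hr : 1 ≤ r) (har : a ≤ r) :
    LocallyOfFiniteType (Spec.map (CommRingCat.ofHom (algebraMap k ↥TA[r, a]))) :=
  haveI : Algebra.FiniteType k ↥TA[r, a] := stub_toric_finiteType k r a hr har
  (HasRingHomProperty.Spec_iff (P := @LocallyOfFiniteType)).mpr
    (RingHom.finiteType_algebraMap.mpr inferInstance)

end Toric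

end Summit.ResolutionOfSingularities.ResolutionOfSingularities.Theorems.FRationalResolution

end
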